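import Summits.BirchSwinnertonDyer.BirchSwinnertonDyer.Theorems.SlopeDichotomyA2DegenerateLocusA2ValueSubgroup
import Summits.BirchSwinnertonDyer.BirchSwinnertonDyer.Theorems.EisensteinPrimesX1AnalyticLambdaCalculus
import Literature.NumberTheory.EllipticCurves.Rank1Residual.ClassX1Isogeny
import HarnessLib

/-!
# T-λ3 on corner A2 read on ANY member of the isogeny class: `λ_an` is a class invariant, so a member with
# `p ∣ ∏c_ℓ` decides it for all — on the census every A2 class has one (E4 from print + λ-transport)

Support file (prover seat `bsd-schneider-i1-c2`, gen 7, cell `bsd-schneider-ideate`; `--supports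
stmt-BirchSwinnertonDyer-19086`), companion of `…DegenerateLocusA2ValueSubgroup.lean` (E4 from print: at every A2
pair with `p ∣ ∏c_ℓ` the regulator–Tamagawa floor holds and `λ_an ≠ 1`, granted Mazur–Tate 1983 §3.3/(4.1.1)
`canonicalPAdicHeight_norm_le_valueSubgroup` + W16, BMS 1.7, GV 1.3, Greenberg 5.10, Mazur–Tate σ, modularity, GZK).

THE REMAINING CASE `p ∤ ∏c_ℓ(W)` (1 765 of the 2 797 census A2 class-pairs). Two roads: road 1 (`…HeightIntegralityNeron`,
isogeny descent ON `W` with the structural hypothesis (red)), or — this file — NO structural hypothesis at all: the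
analytic λ-invariant is a ℚ-ISOGENY-CLASS invariant at a reducible good ordinary prime (tree theorem
`EisensteinPrimesX1AnalyticLambdaCalculus.analyticLambdaEq_of_isIsogenous`, the integral datum at the source
supplied by Wuthrich 2014 Thm. 16; Greenberg–Vatsal 2000 p. 28 «the λ-invariant is always unchanged by an
isogeny»), corner A2 is a class property at the pair (`typeBRankOne_of_isIsogenous`: `ClassX1`, the analytic
rank and the Greenberg–Vatsal parity type transport, x1a), so **`λ_an(W) ≠ 1` as soon as SOME globally minimal
`W' ∼ W` has `p ∣ ∏c_ℓ(W')`** (§2). On the census this is EVERY A2 class: across the degree-`p` isogeny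
`E₁ → E₁/Φ` a split multiplicative Tamagawa number is multiplied or divided by `p` (Dokchitser–Dokchitser 2015
Thm. 23), and kit j257621 found `p ∣ ∏c_ℓ(E₁)` or `p ∣ ∏c_ℓ(E₁/Φ)` on 2 797/2 797 class-pairs (never both prime
to `p`). So after this file T-λ3 holds on ALL 2 797 census pairs modulo NAMED FACTS ONLY plus one decidable
datum per class (a member with `p ∣ ∏c_ℓ`) — no (red), no (comp), no index hypothesis, no height value.

WHAT IS NOT CLAIMED. Class-wide T-λ3 as a datum-free theorem: an A2 class all of whose members have `p ∤ ∏c_ℓ`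
(no split multiplicative prime with `p ∣ c_ℓ` on either side; none below `5·10⁵`, but not excluded in general)
is reached only by road 1 ((red) on the member with the unramified kernel). Item 19086 is untouched
(DECIDED-REDUCED, gens 0–6; refutation budget re-read gen 7); BSD is not advanced; everything is conditional on
the named facts.

* §1 `typeBRankOne_of_isIsogenous`, `typeBRankOne_iff_of_isIsogenous` — corner A2 is a class property.
* §1 `analyticLambdaEq_of_isIsogenous_of_classX1` — λ-transport on class X1 with the W16 datum (packaging of
  the `EisensteinPrimes…` theorem for this series).
* §2 **`not_analyticLambdaEq_one_of_typeBRankOne_of_isIsogenous_dvd_tamagawa`**, `three_le_…` — T-λ3 at `(W, p)`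
  from a member `W'` with `p ∣ ∏c_ℓ(W')`.

References: [MazurTate1983Biext] §3.3, (4.1.1)–(4.1.2), (4.4); [GreenbergVatsal2000] Thm. (1.3), p. 28;
[Wuthrich2014] Thm. 16; [DokchitserDokchitser2015LocalInvariants] Thm. 23; [BalakrishnanMullerStein2015] Thm. 1.7;
[GreenbergLNM1716] Prop. 5.10; memo ROUTE-P3-v8-lambda-g10 §1; FINDING-i1-c2-g6 §2; FINDING-i1-c2-g7.
-/

set_option autoImplicit false

noncomputable section

open scoped Classical MatrixGroups ModularForm

open PowerSeries CongruenceSubgroup WeierstrassCurve Literature.NumberTheory.EllipticCurves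
  Literature.NumberTheory.EllipticCurves.ModularForms
  Literature.NumberTheory.EllipticCurves.Rank1Residual
  Literature.NumberTheory.EllipticCurves.Greenberg1999
  Summit.BirchSwinnertonDyer.Rank1Residual
  Summit.BirchSwinnertonDyer.BirchSwinnertonDyer.Theorems.Rank1ResidualX1Defs
  Summit.BirchSwinnertonDyer.Rank1Residual.X1.MuLambda
  Summit.BirchSwinnertonDyer.Rank1Residual.X1.MuPart
  Summit.BirchSwinnertonDyer.Rank1Residual.X1.ParitySqueeze
  Summit.BirchSwinnertonDyer.BirchSwinnertonDyer.Theses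
  Summit.BirchSwinnertonDyer.BirchSwinnertonDyer.Theorems
  Summit.BirchSwinnertonDyer.BirchSwinnertonDyer.Theorems.DegenerateLocusA2ValueSubgroup

-- `Summit.BirchSwinnertonDyer.BirchSwinnertonDyer.…`: the summit and its single sub-problem share a name (D-0017 layout).
set_option linter.dupNamespace false

namespace Summit.BirchSwinnertonDyer.BirchSwinnertonDyer.Theorems.DegenerateLocusA2ValueSubgroupClass

variable {W W' : WeierstrassCurve ℚ} [W.IsElliptic] [W.IsGloballyMinimal] [W'.IsElliptic] [W'.IsGloballyMinimal]
  {p : ℕ} [Fact p.Prime]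

/-! ## §1. Corner A2 and the analytic λ are ℚ-isogeny-class properties at the pair -/

/-- **Corner A2 is a property of the `ℚ`-isogeny class**: for globally minimal `W ∼ W'`,
`X1.TypeBRankOne W p → X1.TypeBRankOne W' p` — `ClassX1` transports (x1a `ClassX1.of_isIsogenous`), the analytic
rank is an isogeny invariant (equal `L`-functions, `analyticRank_eq_of_isIsogenous'`), and the Greenberg–Vatsal
parity type is an isogeny invariant at an anomalous odd prime (`gvPar_iff_of_isIsogenous_of_anom`).
[cite: GreenbergVatsal2000, Thm. (1.3) (the parity condition) and p. 28] [cite: SilvermanAEC2009, Cor. VII.7.2] -/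
theorem typeBRankOne_of_isIsogenous (h : IsIsogenous W W') (hB : X1.TypeBRankOne W p) :
    X1.TypeBRankOne W' p := by
  obtain ⟨hX, han, hG⟩ := hB
  have hX' : ClassX1 W' p := ClassX1.of_isIsogenous h hX
  have hp2 : p ≠ 2 := by
    have h2 := hX.1
    omega
  have hanom : Anom W p := hX.2.2.2.1
  have hanom' : Anom W' p := Anom.of_isIsogenous h hanom
  exact ⟨hX', (analyticRank_eq_of_isIsogenous' h).symm.trans han,
    (gvPar_iff_of_isIsogenous_of_anom hp2 hanom hanom' h).mp hG⟩

/-- `X1.TypeBRankOne W p ↔ X1.TypeBRankOne W' p` for `ℚ`-isogenous globally minimal `W, W'`.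
[cite: GreenbergVatsal2000, Thm. (1.3) (the parity condition)] [cite: SilvermanAEC2009, Cor. VII.7.2] -/
theorem typeBRankOne_iff_of_isIsogenous (h : IsIsogenous W W') :
    X1.TypeBRankOne W p ↔ X1.TypeBRankOne W' p :=
  ⟨typeBRankOne_of_isIsogenous h, typeBRankOne_of_isIsogenous h.symm_of_charZero⟩

/-- **λ-transport on class X1**: for globally minimal `W ∼ W'` and an odd good ordinary prime `p` with `E[p]`
reducible (`ClassX1 W p`), every certified `λ_an = n` at `W` is certified at `W'` — the tree theorem
`EisensteinPrimesX1AnalyticLambdaCalculus.analyticLambdaEq_of_isIsogenous` with the integral datum at the source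
supplied by Wuthrich 2014 Thm. 16 (`hW16`) and modularity (`hmodP`). [cite: Wuthrich2014, Thm. 16 (p. 393)]
[cite: GreenbergVatsal2000, p. 28 («the λ-invariant is always unchanged by an isogeny»)] -/
theorem analyticLambdaEq_of_isIsogenous_of_classX1 (hW16 : Wuthrich2014.charIdeal_dvd_padicLFunction)
    (hmodP : nonempty_modularParametrizationData) (h : IsIsogenous W W') (hX : ClassX1 W p) {n : ℕ}
    (hn : AnalyticLambdaEq W p n) : AnalyticLambdaEq W' p n := by
  have hXc := isClassX1_of_classX1 hX
  have hgood' : W'.HasGoodReductionAtPrime p := (h.hasGoodReductionAtPrime_iff p).mp hXc.hasGoodReductionAtPrime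
  -- the integral datum at `W` from Wuthrich Thm. 16 at the cyclotomic datum
  have hint : ∀ [NeZero (W.conductorNorm ℤ)] (f : CuspForm (Gamma0 (W.conductorNorm ℤ)) 2),
      IsNewformOf W f → ∀ ϖ : ℚ, (ϖ : ℝ) * W.realPeriodRat = plusPeriod f →
      ∃ g : IwasawaAlgebra p,
        iwasawaToPowerSeries p g = C (ϖ : ℚ_[p]) * padicLFunction f (unitRoot W p : ℚ_[p]) := by
    intro _ f hf ϖ hϖ
    obtain ⟨κ, hκ, γ, hγ, hγ'⟩ := exists_isCyclotomic_isTopGenerator_isCyclotomicVariable_holds p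
    obtain ⟨D⟩ := W.nonempty_selmerDualData_holds κ γ hγ
    obtain ⟨-, g, -, hg⟩ := hW16 W p hXc.two_ne ⟨hXc.hasGoodReductionAtPrime, hXc.not_dvd_frobeniusTrace⟩
      hXc.not_hasIrreducibleModPGaloisRep hκ hγ hγ' hf D ϖ hϖ
    exact ⟨g, hg⟩
  intro hN' f' hf' ϖ' hϖ' g' hg'
  exact EisensteinPrimesX1AnalyticLambdaCalculus.analyticLambdaEq_of_isIsogenous hmodP h
    hXc.hasGoodReductionAtPrime hgood' hint hn f' hf' ϖ' hϖ' g' hg'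

/-! ## §2. T-λ3 at `(W, p)` from ANY member of the class with `p ∣ ∏c_ℓ` -/

/-- **T-λ3 from an isogenous member with `p ∣ ∏c_ℓ`: `λ_an(W) ≠ 1`** at an A2 pair `(W, p)` as soon as some
globally minimal `W' ∼ W` has `p ∣ ∏c_ℓ(W')` (e.g. `W' = W`; on the census, `W' = E₁` or `E₁/Φ` always works,
kit j257621). Published inputs BY NAME only: W16, Perrin-Riou–Schneider (BMS 1.7), GV Thm. 1.3, Greenberg
Prop. 5.10, Mazur–Tate σ, modularity, GZK, and Mazur–Tate 1983 §3.3/(4.1.1) (`hVS`); NO structural hypothesis,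
NO height value inspected. Mechanism: a certificate `λ_an(W) = 1` would transport to `W'` (§1), where
`…ValueSubgroup.not_analyticLambdaEq_one_of_typeBRankOne_of_dvd_tamagawa_of_valueSubgroup` forbids it.
[cite: MazurTate1983Biext, §3.3 and (4.1.1)–(4.1.2)] [cite: GreenbergVatsal2000, Thm. (1.3) and p. 28]
[cite: Wuthrich2014, Thm. 16 (p. 393)] [cite: BalakrishnanMullerStein2015, Thm. 1.7]
[cite: GreenbergLNM1716, Prop. 5.10 (PDF p. 147)] [cite: DokchitserDokchitser2015LocalInvariants, Thm. 23] -/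
theorem not_analyticLambdaEq_one_of_typeBRankOne_of_isIsogenous_dvd_tamagawa
    (hW16 : Wuthrich2014.charIdeal_dvd_padicLFunction) (hS : Schneider1985_order_charGenerator_odd)
    (hGV : GreenbergVatsal2000.thm13_charIdeal_eq_of_gvPar)
    (h510 : prop510_isTorsion_hasUnitContent_of_gvPar) (hMT : mazur_tate_sigma_exists_odd)
    (hmodP : nonempty_modularParametrizationData) (hGZK : rank_eq_analyticRank_of_analyticRank_le_one)
    (hVS : Literature.NumberTheory.EllipticCurves.canonicalPAdicHeight_norm_le_valueSubgroup)
    (hB : X1.TypeBRankOne W p) (h : IsIsogenous W W') (hTam' : p ∣ W'.tamagawaProduct) :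
    ¬ AnalyticLambdaEq W p 1 := fun h1 ↦
  DegenerateLocusA2ValueSubgroup.not_analyticLambdaEq_one_of_typeBRankOne_of_dvd_tamagawa_of_valueSubgroup
    hW16 hS hGV h510 hMT hmodP hGZK hVS (typeBRankOne_of_isIsogenous h hB) hTam'
    (analyticLambdaEq_of_isIsogenous_of_classX1 hW16 hmodP h hB.1 h1)

/-- **T-λ3, counted form, from an isogenous member with `p ∣ ∏c_ℓ`: every certified `λ_an(W) = n` has `n ≥ 3`.**
[cite: MazurTate1983Biext, §3.3 and (4.1.1)–(4.1.2)] [cite: GreenbergVatsal2000, Thm. (1.3) and p. 28]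
[cite: MazurTateTeitelbaum1986Invent, §I.17–I.18] [cite: BalakrishnanMullerStein2015, Thm. 1.7] -/
theorem three_le_of_analyticLambdaEq_of_typeBRankOne_of_isIsogenous_dvd_tamagawa
    (hW16 : Wuthrich2014.charIdeal_dvd_padicLFunction) (hS : Schneider1985_order_charGenerator_odd)
    (hGV : GreenbergVatsal2000.thm13_charIdeal_eq_of_gvPar)
    (h510 : prop510_isTorsion_hasUnitContent_of_gvPar) (hMT : mazur_tate_sigma_exists_odd)
    (hmodP : nonempty_modularParametrizationData) (hGZK : rank_eq_analyticRank_of_analyticRank_le_one)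
    (hVS : Literature.NumberTheory.EllipticCurves.canonicalPAdicHeight_norm_le_valueSubgroup)
    (hB : X1.TypeBRankOne W p) (h : IsIsogenous W W') (hTam' : p ∣ W'.tamagawaProduct)
    {n : ℕ} (hn : AnalyticLambdaEq W p n) : 3 ≤ n :=
  DegenerateLocusA2ValueSubgroup.three_le_of_analyticLambdaEq_of_typeBRankOne_of_dvd_tamagawa_of_valueSubgroup
    hW16 hS hGV h510 hMT hmodP hGZK hVS (typeBRankOne_of_isIsogenous h hB) hTam'
    (analyticLambdaEq_of_isIsogenous_of_classX1 hW16 hmodP h hB.1 hn)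

end Summit.BirchSwinnertonDyer.BirchSwinnertonDyer.Theorems.DegenerateLocusA2ValueSubgroupClass

end
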